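import Mathlib

/-!
# Isotropic subspaces of alternating forms: `finrank D + finrank rad(D) ≤ 2 · finrank N` (ROUND-24, T24.11c infrastructure)

FRONTIER range-avoidance ladder, rung F-N3, ROUND 24 (cell `pnp-ideate`; free-standing linear algebra for the rank route of the
graph-quadratic gap targets `PstarGraphQuadGap.GraphQuadGapTwo` and the bounded-`s` gap function — nothing here bears on `P` versus
`NP`).

**Lemma (`exists_isotropic`).**  Let `B` be a bilinear form on a finite-dimensional space `M` over a field `K` and `D ≤ M` a subspace
on which `B` is ALTERNATING (`B v v = 0` for `v ∈ D`).  Then `D` contains a subspace `N`, totally isotropic for `B`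
(`B u v = 0` for `u, v ∈ N`), with

  `finrank D + finrank (D ⊓ B.orthogonal D) ≤ 2 · finrank N`

(`D ⊓ B.orthogonal D` is the radical of `B|_D`; in rank language `finrank N ≥ finrank D − (rank B|_D)/2`, a Lagrangian subspace of
the non-degenerate quotient pulled back).  Proof: induction on `finrank D`; if `B|_D ≠ 0` pick `u, v ∈ D` with `B u v ≠ 0`, recurse on
`D' = D ⊓ ker (B u) ⊓ ker (B v)` (dimension drop `≤ 2`, `finrank_le_finrank_inf_ker_add_one`; the radical of `D` lies in that of `D'`),
and add `u` to the isotropic subspace found there (`u ⊥ D'`, `u ∉ D'` by skew-symmetry `B v u = −B u v`).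

Use (sequel `PstarQuadBias` / `PstarGraphQuadGapTwo`): over `𝔽₂` the bias `ε = Σ_{a ∈ b₀ + D} (−1)^{Q(a)+ℓ(a)}` of a quadratic
function satisfies `ε² ≤ |D| · |D ⊓ rad|`, hence `|ε| ≤ 2^{finrank N}` for the `N` of this lemma, while `PstarGraphQuadGapOne.
card_le_of_isotropic` bounds the number of edges of the graph form by `2Δ² · codim N`.
-/

set_option linter.dupNamespace false -- `Summit.PneNP.PneNP.…`: summit = sub-problem name (D-0017 single-conjunct layout)

open Module Submodule

namespace Summit.PneNP.PneNP.Theorems.PstarLagrangian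

variable {K : Type*} [Field K] {M : Type*} [AddCommGroup M] [Module K M]

/-- An alternating form is skew-symmetric: `B a b = −B b a` on `D`. -/
theorem skew_of_alternating (B : LinearMap.BilinForm K M) {D : Submodule K M} (halt : ∀ v ∈ D, B v v = 0)
    {a b : M} (ha : a ∈ D) (hb : b ∈ D) : B a b = -B b a := by
  have h := halt (a + b) (D.add_mem ha hb)
  simp only [map_add, LinearMap.add_apply, halt a ha, halt b hb, zero_add, add_zero] at h
  linear_combination h

variable [FiniteDimensional K M]

/-- Cutting a subspace by a hyperplane `ker f` loses at most one dimension. -/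
theorem finrank_le_finrank_inf_ker_add_one (D : Submodule K M) (f : M →ₗ[K] K) :
    finrank K D ≤ finrank K ↥(D ⊓ LinearMap.ker f) + 1 := by
  have h1 := Submodule.finrank_sup_add_finrank_inf_eq D (LinearMap.ker f)
  have h2 := LinearMap.finrank_range_add_finrank_ker f
  have h3 : finrank K (LinearMap.range f) ≤ 1 := by
    calc finrank K (LinearMap.range f) ≤ finrank K K := Submodule.finrank_le _
      _ = 1 := finrank_self K
  have h4 : finrank K ↥(D ⊔ LinearMap.ker f) ≤ finrank K M := Submodule.finrank_le _
  omega

/-- The induction behind `exists_isotropic` (on a bound `d` for `finrank D`). -/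
theorem exists_isotropic_aux (B : LinearMap.BilinForm K M) :
    ∀ (d : ℕ) (D : Submodule K M), finrank K D ≤ d → (∀ v ∈ D, B v v = 0) →
      ∃ N : Submodule K M, N ≤ D ∧ (∀ u ∈ N, ∀ v ∈ N, B u v = 0) ∧
        finrank K D + finrank K ↥(D ⊓ B.orthogonal D) ≤ 2 * finrank K N := by
  intro d
  induction d with
  | zero =>
    intro D hD _
    have hbot : D = ⊥ := Submodule.finrank_eq_zero.1 (Nat.le_zero.1 hD)
    refine ⟨D, le_rfl, fun u hu v _ => ?_, ?_⟩
    · rw [hbot, mem_bot] at hu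
      rw [hu, map_zero, LinearMap.zero_apply]
    · have := Submodule.finrank_mono (inf_le_left : D ⊓ B.orthogonal D ≤ D)
      omega
  | succ d ih =>
    intro D hD halt
    by_cases hzero : ∀ u ∈ D, ∀ v ∈ D, B u v = 0
    · refine ⟨D, le_rfl, hzero, ?_⟩
      have := Submodule.finrank_mono (inf_le_left : D ⊓ B.orthogonal D ≤ D)
      omega
    push Not at hzero
    obtain ⟨u, hu, v, hv, huv⟩ := hzero
    have hskew := fun {a b : M} (ha : a ∈ D) (hb : b ∈ D) => skew_of_alternating B halt ha hb
    -- the sub-subspace orthogonal to `u` and `v`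
    obtain ⟨D', hD'⟩ : ∃ D' : Submodule K M, D' = D ⊓ LinearMap.ker (B u) ⊓ LinearMap.ker (B v) := ⟨_, rfl⟩
    have hD'D : D' ≤ D := by rw [hD']; exact inf_le_left.trans inf_le_left
    have hmemD' : ∀ {w}, w ∈ D' → B u w = 0 ∧ B v w = 0 := by
      intro w hw
      rw [hD', mem_inf, mem_inf, LinearMap.mem_ker, LinearMap.mem_ker] at hw
      exact ⟨hw.1.2, hw.2⟩
    have huD' : u ∉ D' := by
      intro h
      apply huv
      rw [hskew hu hv, (hmemD' h).2, neg_zero]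
    have hlt : D' < D := lt_of_le_of_ne hD'D fun h => huD' (h ▸ hu)
    have hdim : finrank K D ≤ finrank K D' + 2 := by
      have e1 := finrank_le_finrank_inf_ker_add_one D (B u)
      have e2 := finrank_le_finrank_inf_ker_add_one (D ⊓ LinearMap.ker (B u)) (B v)
      rw [← hD'] at e2
      omega
    have hfin : finrank K D' ≤ d := by
      have := Submodule.finrank_lt_finrank_of_lt hlt
      omega
    obtain ⟨N', hN'D', hN'iso, hN'dim⟩ := ih D' hfin fun w hw => halt w (hD'D hw)
    -- the radical of `D` lies in the radical of `D'`
    have hR : D ⊓ B.orthogonal D ≤ D' ⊓ B.orthogonal D' := by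
      intro r hr
      obtain ⟨hrD, hrO⟩ := mem_inf.1 hr
      rw [LinearMap.BilinForm.mem_orthogonal_iff] at hrO
      refine mem_inf.2 ⟨?_, ?_⟩
      · rw [hD', mem_inf, mem_inf, LinearMap.mem_ker, LinearMap.mem_ker]
        exact ⟨⟨hrD, hrO u hu⟩, hrO v hv⟩
      · rw [LinearMap.BilinForm.mem_orthogonal_iff]
        exact fun n hn => hrO n (hD'D hn)
    have hRdim := Submodule.finrank_mono hR
    -- add `u`
    have hu0 : u ≠ 0 := by
      rintro rfl
      exact huv (by rw [map_zero, LinearMap.zero_apply])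
    refine ⟨N' ⊔ Submodule.span K {u},
      sup_le (hN'D'.trans hD'D) ((span_singleton_le_iff_mem u D).2 hu), ?_, ?_⟩
    · intro a ha b hb
      obtain ⟨a₁, ha₁, a₂, ha₂, rfl⟩ := mem_sup.1 ha
      obtain ⟨b₁, hb₁, b₂, hb₂, rfl⟩ := mem_sup.1 hb
      obtain ⟨α, rfl⟩ := mem_span_singleton.1 ha₂
      obtain ⟨β, rfl⟩ := mem_span_singleton.1 hb₂
      have h1 : B a₁ b₁ = 0 := hN'iso a₁ ha₁ b₁ hb₁
      have h2 : B u b₁ = 0 := (hmemD' (hN'D' hb₁)).1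
      have h3 : B a₁ u = 0 := by
        rw [hskew (hD'D (hN'D' ha₁)) hu, (hmemD' (hN'D' ha₁)).1, neg_zero]
      have h4 : B u u = 0 := halt u hu
      simp only [map_add, map_smul, LinearMap.add_apply, LinearMap.smul_apply, smul_eq_mul, h1, h2, h3, h4,
        mul_zero, add_zero]
    · have hdisj : N' ⊓ Submodule.span K {u} = ⊥ :=
        disjoint_iff.1 ((disjoint_span_singleton' hu0).2 fun h => huD' (hN'D' h))
      have e := Submodule.finrank_sup_add_finrank_inf_eq N' (Submodule.span K {u})
      rw [hdisj, finrank_bot, add_zero, finrank_span_singleton hu0] at e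
      omega

/-- **Isotropic subspaces of alternating forms.**  If `B` is alternating on the subspace `D` then `D` contains a totally isotropic
subspace `N` with `finrank D + finrank (D ⊓ B.orthogonal D) ≤ 2 · finrank N`. -/
theorem exists_isotropic (B : LinearMap.BilinForm K M) (D : Submodule K M) (halt : ∀ v ∈ D, B v v = 0) :
    ∃ N : Submodule K M, N ≤ D ∧ (∀ u ∈ N, ∀ v ∈ N, B u v = 0) ∧
      finrank K D + finrank K ↥(D ⊓ B.orthogonal D) ≤ 2 * finrank K N :=
  exists_isotropic_aux B (finrank K D) D le_rfl halt

end Summit.PneNP.PneNP.Theorems.PstarLagrangian
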